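import Summits.KontsevichZagierPeriods.KontsevichZagierPeriods.Theorems.LinRedNormalFormArrangementNormalFormStubRebaseSimplePosOneFibreCornerNorm

/-!
# Stub `stub_rebaseSimplePosOneZero` (crux `ArrangementNormalForm`, line `janus-bands`) —
part `CornerBlow`: the blow-up of a corner, flat chart

Corner toolkit for the double-corner bands at `B = 1`, second file. A literal one-fibre datum
over the base `(x, y)` with base pole `y = 0`, letter `0`, transverse bounds `u < t < v` through
the origin (`u(0) = v(0) = 0`), whose base cell is the FLAT sector piece
`{rows, 0 < y < x < ε}` (rows through the origin or `y`-free), is moved by the blow-up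
`x = ρ`, `y = ρ η`, `t = ρ θ` (rule 2, Jacobian `ρ²`) to the literal datum
`[{rows', 0 < ρ < ε, 0 < η < 1, U(η) < θ < V(η)}, R(ρ)/η · 1/θ]` with the SAME literal integrand
text and `ρ`-FREE bounds `U = u/ρ`, `V = v/ρ` (`RebasePos.cornerBlowUp`): the apex level of the
new band is the constant `κ/ρ`, so the new band has no corner.

References: M. Kontsevich, D. Zagier, *Periods* (2001), §1.2, rule (2).
-/

noncomputable section

open Set MeasureTheory MvPolynomial
open Literature.NumberTheory.Transcendental Literature.ModelTheory.ExponentialFields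

namespace Summit.KontsevichZagierPeriods.ArrangementNormalForm.JanusBands

namespace RebasePos

open SeparatePos

section BlowData

variable {m m' : ℕ}

/-- The flat blow-up `(ρ, η, θ) ↦ (ρ, ρ η, ρ θ)`. -/
def blowL (w : Fin (1 + 1 + 1) → ℝ) : Fin (1 + 1 + 1) → ℝ := ![w 0, w 0 * w 1, w 0 * w 2]

/-- Its inverse `(x, y, t) ↦ (x, y/x, t/x)`. -/
def blowLInv (z : Fin (1 + 1 + 1) → ℝ) : Fin (1 + 1 + 1) → ℝ := ![z 0, z 1 / z 0, z 2 / z 0]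

/-- The Jacobian matrix of `blowL`. -/
def blowLMat (w : Fin (1 + 1 + 1) → ℝ) : Matrix (Fin (1 + 1 + 1)) (Fin (1 + 1 + 1)) ℝ :=
  !![1, 0, 0; w 1, w 0, 0; w 2, 0, w 0]

/-- The derivative of `blowL`. -/
def blowLLin (w : Fin (1 + 1 + 1) → ℝ) : (Fin (1 + 1 + 1) → ℝ) →L[ℝ] (Fin (1 + 1 + 1) → ℝ) :=
  LinearMap.toContinuousLinearMap (Matrix.toLin' (blowLMat w))

/-- A row through the origin, read in the chart: `c_x x + c_y y = ρ (c_x + c_y η)`; `y`-free rows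
are kept. -/
def chartRowL (c : (Fin (1 + 1) → ℚ) × ℚ) : (Fin (1 + 1) → ℚ) × ℚ :=
  if c.1 1 = 0 then c else (![0, c.1 1], c.1 0)

/-- A bound through the origin, read in the chart: `u = ρ U(η)`, `U = u_y η + u_x`. -/
def chartFL (c : (Fin (1 + 1) → ℚ) × ℚ) : (Fin (1 + 1) → ℚ) × ℚ := (![0, c.1 1], c.1 0)

/-- The four rows of the flat sector piece: `x > 0`, `y > 0`, `x − y > 0`, `ε − x > 0`. -/
def boxRowsL (ε : ℚ) : Fin 4 → (Fin (1 + 1) → ℚ) × ℚ :=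
  ![(![1, 0], 0), (![0, 1], 0), (![1, -1], 0), (![-1, 0], ε)]

/-- Their chart images: `ρ > 0`, `η > 0`, `1 − η > 0`, `ε − ρ > 0`. -/
def outRowsL (ε : ℚ) : Fin 4 → (Fin (1 + 1) → ℚ) × ℚ :=
  ![(![1, 0], 0), (![0, 1], 0), (![0, -1], 1), (![-1, 0], ε)]

/-- `blowL` on the `x`-slot. -/
@[simp] theorem blowL_zero (w : Fin (1 + 1 + 1) → ℝ) : blowL w 0 = w 0 := rfl

/-- `blowL` on the `y`-slot. -/
@[simp] theorem blowL_one (w : Fin (1 + 1 + 1) → ℝ) : blowL w 1 = w 0 * w 1 := rfl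

/-- `blowL` on the `t`-slot. -/
@[simp] theorem blowL_two (w : Fin (1 + 1 + 1) → ℝ) : blowL w 2 = w 0 * w 2 := rfl

/-- Silent forms are unchanged by `blowL`. -/
@[simp] theorem affB_blowL (d : (Fin 1 → ℚ) × ℚ) (w : Fin (1 + 1 + 1) → ℝ) :
    affB 1 1 d (blowL w) = affB 1 1 d w := by
  rw [affB_two, affB_two, blowL_zero]

/-- Rows through the origin or `y`-free, read in the chart (for `ρ > 0`). -/
theorem affF_blowL_pos_iff (c : (Fin (1 + 1) → ℚ) × ℚ) (hc : c.1 1 ≠ 0 → c.2 = 0)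
    (w : Fin (1 + 1 + 1) → ℝ) (hρ : 0 < w 0) :
    0 < affF 1 1 c (blowL w) ↔ 0 < affF 1 1 (chartRowL c) w := by
  by_cases h : c.1 1 = 0
  · rw [chartRowL, if_pos h, affF_two, affF_two, h]
    simp
  · have h2 : c.2 = 0 := hc h
    rw [chartRowL, if_neg h, affF_two, affF_two, h2]
    simp only [blowL_zero, blowL_one, Rat.cast_zero, add_zero, Matrix.cons_val_zero, zero_mul,
      Matrix.cons_val_one, zero_add]
    rw [show (c.1 0 : ℝ) * w 0 + (c.1 1 : ℝ) * (w 0 * w 1) = w 0 * ((c.1 1 : ℝ) * w 1 + c.1 0) by ring]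
    exact ⟨fun h' => pos_of_mul_pos_right h' hρ.le, fun h' => mul_pos hρ h'⟩

/-- Bounds through the origin, read in the chart. -/
theorem affF_blowL_eq (c : (Fin (1 + 1) → ℚ) × ℚ) (hc : c.2 = 0) (w : Fin (1 + 1 + 1) → ℝ) :
    affF 1 1 c (blowL w) = w 0 * affF 1 1 (chartFL c) w := by
  rw [affF_two, affF_two, chartFL, hc]
  simp only [blowL_zero, blowL_one, Rat.cast_zero, add_zero, Matrix.cons_val_zero, zero_mul,
    Matrix.cons_val_one, zero_add]
  ring

/-- The four sector rows, read in the chart. -/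
theorem boxRowsL_iff (ε : ℚ) (w : Fin (1 + 1 + 1) → ℝ) :
    (∀ k, 0 < affF 1 1 (boxRowsL ε k) (blowL w)) ↔ (∀ k, 0 < affF 1 1 (outRowsL ε k) w) := by
  simp only [Fin.forall_fin_succ, IsEmpty.forall_iff, and_true]
  simp [boxRowsL, outRowsL, affF_two]
  intro h0
  constructor
  · rintro ⟨h1, h2, h3⟩
    exact ⟨pos_of_mul_pos_right h1 h0.le, by nlinarith, by linarith⟩
  · rintro ⟨h1, h2, h3⟩
    exact ⟨mul_pos h0 h1, by nlinarith, by linarith⟩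

end BlowData

section BlowCalc

/-- `blowLLin` in coordinates. -/
theorem blowLLin_apply (w v : Fin (1 + 1 + 1) → ℝ) :
    blowLLin w v = ![v 0, w 1 * v 0 + w 0 * v 1, w 2 * v 0 + w 0 * v 2] := by
  rw [blowLLin, LinearMap.coe_toContinuousLinearMap', Matrix.toLin'_apply]
  funext l
  fin_cases l <;> simp [blowLMat, Matrix.mulVec, dotProduct, Fin.sum_univ_three]

/-- The Jacobian determinant of `blowL` is `ρ²`. -/
theorem blowLLin_det (w : Fin (1 + 1 + 1) → ℝ) : (blowLLin w).det = w 0 * w 0 := by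
  rw [blowLLin, ContinuousLinearMap.det, LinearMap.coe_toContinuousLinearMap, LinearMap.det_toLin',
    blowLMat, Matrix.det_fin_three]
  simp

/-- `blowL` has derivative `blowLLin`. -/
theorem hasFDerivAt_blowL (w : Fin (1 + 1 + 1) → ℝ) : HasFDerivAt blowL (blowLLin w) w := by
  have h0 := hasFDerivAt_apply (𝕜 := ℝ) (0 : Fin (1 + 1 + 1)) w
  have h1 := hasFDerivAt_apply (𝕜 := ℝ) (1 : Fin (1 + 1 + 1)) w
  have h2 := hasFDerivAt_apply (𝕜 := ℝ) (2 : Fin (1 + 1 + 1)) w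
  refine hasFDerivAt_pi'' fun l => ?_
  fin_cases l
  · refine (h0.congr_fderiv ?_).congr_of_eventuallyEq (Filter.Eventually.of_forall fun x => rfl)
    ext v
    simp [blowLLin_apply]
  · refine ((h0.mul h1).congr_fderiv ?_).congr_of_eventuallyEq (Filter.Eventually.of_forall fun x => rfl)
    ext v
    simp [blowLLin_apply]
    ring
  · refine ((h0.mul h2).congr_fderiv ?_).congr_of_eventuallyEq (Filter.Eventually.of_forall fun x => rfl)
    ext v
    simp [blowLLin_apply]
    ring

/-- `blowL ∘ blowLInv = id` off `x = 0`. -/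
theorem blowL_blowLInv (z : Fin (1 + 1 + 1) → ℝ) (hz : z 0 ≠ 0) : blowL (blowLInv z) = z := by
  funext l
  fin_cases l
  · rfl
  · simp only [blowL, blowLInv, Fin.mk_one, Matrix.cons_val_one, Matrix.cons_val_zero, Matrix.cons_val]
    field_simp
  · simp only [blowL, blowLInv, Fin.reduceFinMk, Matrix.cons_val, Matrix.cons_val_zero]
    field_simp

/-- `blowLInv ∘ blowL = id` off `ρ = 0`. -/
theorem blowLInv_blowL (w : Fin (1 + 1 + 1) → ℝ) (hw : w 0 ≠ 0) : blowLInv (blowL w) = w := by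
  funext l
  fin_cases l
  · rfl
  · simp only [blowL, blowLInv, Fin.mk_one, Matrix.cons_val_one, Matrix.cons_val_zero, Matrix.cons_val]
    field_simp
  · simp only [blowL, blowLInv, Fin.reduceFinMk, Matrix.cons_val, Matrix.cons_val_zero]
    field_simp

/-- `blowL` as a polynomial map. -/
def blowLPoly : Fin (1 + 1 + 1) → MvPolynomial (Fin (1 + 1 + 1)) ℚ := ![X 0, X 0 * X 1, X 0 * X 2]

/-- `blowLPoly` evaluates to `blowL`. -/
theorem aeval_blowLPoly (w : Fin (1 + 1 + 1) → ℝ) :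
    (fun l => MvPolynomial.aeval w (blowLPoly l)) = blowL w := by
  funext l
  fin_cases l <;> simp [blowLPoly, blowL]

/-- **Bounded literal one-fibre domains from a bounded base cell**: if the base coordinates are
bounded by `R₀` on the base cell, the literal domain `{rows, U < t < V}` is bounded. -/
theorem isBounded_gDom_of_base {k : ℕ} (N : Fin k → (Fin (1 + 1) → ℚ) × ℚ) (U V : (Fin (1 + 1) → ℚ) × ℚ)
    (R₀ : ℝ) (h : ∀ w : Fin (1 + 1 + 1) → ℝ, (∀ j, 0 < affF 1 1 (N j) w) → |w 0| ≤ R₀ ∧ |w 1| ≤ R₀) :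
    Bornology.IsBounded (gDom 1 1 k N (fun _ => Sum.inr U) (fun _ => Sum.inr V)) := by
  set RU : ℝ := (∑ j, |(U.1 j : ℝ)|) * R₀ + |(U.2 : ℝ)| with hRU
  set RV : ℝ := (∑ j, |(V.1 j : ℝ)|) * R₀ + |(V.2 : ℝ)| with hRV
  refine isBounded_of_forall_abs_le (max R₀ (max RU RV)) fun w hw l => ?_
  rw [mem_gDom_one] at hw
  obtain ⟨hrow, hlo, hhi⟩ := hw
  obtain ⟨hx, hy⟩ := h w hrow
  have hb : ∀ j : Fin (1 + 1), |w (Fin.castAdd 1 j)| ≤ R₀ := fun j => by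
    fin_cases j
    · exact hx
    · exact hy
  have hU := abs_affF_le U hb
  have hV := abs_affF_le V hb
  rw [it_eq] at hlo hhi
  fin_cases l
  · exact hx.trans (le_max_left _ _)
  · exact hy.trans (le_max_left _ _)
  · show |w 2| ≤ max R₀ (max RU RV)
    refine le_trans ?_ (le_max_right _ _)
    rw [abs_le] at hU hV ⊢
    constructor
    · exact le_trans (by linarith [le_max_left RU RV] : -max RU RV ≤ -RU) (by linarith)
    · exact le_trans (by linarith : w 2 ≤ RV) (le_max_right _ _)

end BlowCalc

section BlowMove

variable {m m' : ℕ}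

/-- Membership in a literal one-fibre domain whose rows are an appended family. -/
theorem mem_gDom_append {k k' : ℕ} (N : Fin k → (Fin (1 + 1) → ℚ) × ℚ)
    (N' : Fin k' → (Fin (1 + 1) → ℚ) × ℚ) (U V : (Fin (1 + 1) → ℚ) × ℚ) (z : Fin (1 + 1 + 1) → ℝ) :
    z ∈ gDom 1 1 (k + k') (Fin.append N N') (fun _ => Sum.inr U) (fun _ => Sum.inr V) ↔
      ((∀ j, 0 < affF 1 1 (N j) z) ∧ ∀ j, 0 < affF 1 1 (N' j) z) ∧
        affF 1 1 U z < z 2 ∧ z 2 < affF 1 1 V z := by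
  rw [mem_gDom_one, Fin.forall_fin_add, it_eq]
  simp only [Fin.append_left, Fin.append_right]

/-- The chart rows give `0 < ρ < ε`, `0 < η < 1`. -/
theorem outRowsL_bounds (ε : ℚ) (w : Fin (1 + 1 + 1) → ℝ) (hw : ∀ k, 0 < affF 1 1 (outRowsL ε k) w) :
    0 < w 0 ∧ w 0 < ε ∧ 0 < w 1 ∧ w 1 < 1 := by
  have h0 := hw 0
  have h1 := hw 1
  have h2 := hw 2
  have h3 := hw 3
  simp only [outRowsL, affF_two, Matrix.cons_val_zero, Matrix.cons_val_one, Matrix.cons_val,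
    Rat.cast_one, one_mul, Rat.cast_zero, zero_mul, add_zero, zero_add, Rat.cast_neg, neg_mul] at h0 h1 h2 h3
  exact ⟨h0, by linarith, h1, by linarith⟩

/-- The sector rows give `x > 0`. -/
theorem boxRowsL_pos (ε : ℚ) (z : Fin (1 + 1 + 1) → ℝ) (hz : ∀ k, 0 < affF 1 1 (boxRowsL ε k) z) :
    0 < z 0 := by
  have h0 := hz 0
  simp only [boxRowsL, affF_two, Matrix.cons_val_zero, Matrix.cons_val_one, Rat.cast_one, one_mul,
    Rat.cast_zero, zero_mul, add_zero] at h0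
  exact h0

/-- **The blow-up of a corner, flat chart** (rule 2 with `x = ρ`, `y = ρ η`, `t = ρ θ`,
Jacobian `ρ²`). See the module docstring. The rows `M` must pass through the origin unless they
are `y`-free (`hM`), the bounds pass through the origin (`hu`, `hv`); the literal integrand text
is unchanged and the new bounds `chartFL u`, `chartFL v` are `ρ`-free. -/
theorem cornerBlowUp (ε : ℚ) (s : KZ.IntegralRep (1 + 1 + 1)) (M : Fin m' → (Fin (1 + 1) → ℚ) × ℚ)
    (L : Fin m → (Fin 1 → ℚ) × ℚ) (e : Fin m → ℕ) (p : MvPolynomial (Fin 1) ℚ) (ℓ₁ : (Fin 1 → ℚ) × ℚ)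
    (u v : (Fin (1 + 1) → ℚ) × ℚ)
    (hdom : s.domain = gDom 1 1 (m' + 4) (Fin.append M (boxRowsL ε)) (fun _ => Sum.inr u)
      (fun _ => Sum.inr v))
    (hint : EqOn s.integrand (glit 1 1 p L e ℓ₁ 0 0 1 (fun _ => some 0)) s.domain)
    (hM : ∀ j, (M j).1 1 ≠ 0 → (M j).2 = 0) (hu : u.2 = 0) (hv : v.2 = 0) :
    ∃ s' : KZ.IntegralRep (1 + 1 + 1), Bornology.IsBounded s'.domain ∧
      s'.domain = gDom 1 1 (m' + 4) (Fin.append (fun j => chartRowL (M j)) (outRowsL ε))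
        (fun _ => Sum.inr (chartFL u)) (fun _ => Sum.inr (chartFL v)) ∧
      s'.integrand = glit 1 1 p L e ℓ₁ 0 0 1 (fun _ => some 0) ∧
      (∀ w, w ∈ s'.domain ↔ blowL w ∈ s.domain) ∧
      KZ.of s - KZ.of s' ∈ KZ.relations := by
  set R := gDom 1 1 (m' + 4) (Fin.append (fun j => chartRowL (M j)) (outRowsL ε))
    (fun _ => Sum.inr (chartFL u)) (fun _ => Sum.inr (chartFL v)) with hR
  -- membership
  have hΨdom : ∀ w, w ∈ R ↔ blowL w ∈ s.domain := fun w => by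
    rw [hR, mem_gDom_append, hdom, mem_gDom_append, boxRowsL_iff]
    constructor
    · rintro ⟨⟨hrow, hbox⟩, hlo, hhi⟩
      obtain ⟨hρ, -, -, -⟩ := outRowsL_bounds ε w hbox
      refine ⟨⟨fun j => (affF_blowL_pos_iff (M j) (hM j) w hρ).2 (hrow j), hbox⟩, ?_, ?_⟩
      · rw [affF_blowL_eq u hu, blowL_two]
        exact mul_lt_mul_of_pos_left hlo hρ
      · rw [affF_blowL_eq v hv, blowL_two]
        exact mul_lt_mul_of_pos_left hhi hρ
    · rintro ⟨⟨hrow, hbox⟩, hlo, hhi⟩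
      obtain ⟨hρ, -, -, -⟩ := outRowsL_bounds ε w hbox
      refine ⟨⟨fun j => (affF_blowL_pos_iff (M j) (hM j) w hρ).1 (hrow j), hbox⟩, ?_, ?_⟩
      · rw [affF_blowL_eq u hu, blowL_two] at hlo
        exact lt_of_mul_lt_mul_left hlo hρ.le
      · rw [affF_blowL_eq v hv, blowL_two] at hhi
        exact lt_of_mul_lt_mul_left hhi hρ.le
  have hbR : ∀ w ∈ R, 0 < w 0 ∧ w 0 < ε ∧ 0 < w 1 ∧ w 1 < 1 := fun w hw => by
    rw [hR, mem_gDom_append] at hw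
    exact outRowsL_bounds ε w hw.1.2
  have hxD : ∀ z ∈ s.domain, 0 < z 0 := fun z hz => by
    rw [hdom, mem_gDom_append] at hz
    exact boxRowsL_pos ε z hz.1.2
  have himg : blowL '' R = s.domain := by
    ext z
    constructor
    · rintro ⟨w, hw, rfl⟩
      exact (hΨdom w).1 hw
    · intro hz
      exact ⟨blowLInv z, (hΨdom _).2 (by rw [blowL_blowLInv z (hxD z hz).ne']; exact hz),
        blowL_blowLInv z (hxD z hz).ne'⟩
  have hinj : InjOn blowL R := fun w hw w' hw' h => by
    rw [← blowLInv_blowL w (hbR w hw).1.ne', h, blowLInv_blowL w' (hbR w' hw').1.ne']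
  -- the integrand identity
  have hf : ∀ w ∈ R, glit 1 1 p L e ℓ₁ 0 0 1 (fun _ => some 0) w =
      s.integrand (blowL w) * |(blowLLin w).det| := by
    intro w hw
    obtain ⟨hρ, -, hη, -⟩ := hbR w hw
    have h0 : affB 1 1 (0 : (Fin 1 → ℚ) × ℚ) w = 0 := by simp [affB_two]
    rw [hint ((hΨdom w).1 hw), blowLLin_det, abs_of_pos (mul_pos hρ hρ), glit_two, glit_two]
    simp only [affB_blowL, blowL_zero, blowL_one, blowL_two, h0, sub_zero]
    rcases eq_or_ne (w 2) 0 with h2 | h2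
    · rw [h2]
      simp
    · field_simp
  have hRsa : IsSemialgebraic ℚ R := isSemialgebraic_gDom _ _ _ _
  have hsa : IsSemialgebraicMapOn ℚ R blowL :=
    (isSemialgebraicMapOn_aeval hRsa blowLPoly).congr fun w _ => aeval_blowLPoly w
  obtain ⟨s', hd', hi', hrel⟩ := cov_glit s _ _ _ p L e ℓ₁ 0 0 1 blowL blowLLin hsa
    (fun w _ => hasFDerivAt_blowL w) hinj himg hf
  refine ⟨s', ?_, hd', hi', fun w => by rw [hd']; exact hΨdom w, hrel⟩
  rw [hd']
  refine isBounded_gDom_of_base _ _ _ (max (ε : ℝ) 1) fun w hw => ?_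
  rw [Fin.forall_fin_add] at hw
  simp only [Fin.append_right] at hw
  obtain ⟨hρ, hρε, hη, hη1⟩ := outRowsL_bounds ε w hw.2
  exact ⟨by rw [abs_of_pos hρ]; exact hρε.le.trans (le_max_left _ _),
    by rw [abs_of_pos hη]; exact hη1.le.trans (le_max_right _ _)⟩

end BlowMove

end RebasePos

/-- **Registered part of `stub_rebaseSimplePosOneZero` (line `janus-bands`): the blow-up of a
corner, flat chart** (`RebasePos.cornerBlowUp`, rule 2 with `x = ρ`, `y = ρ η`, `t = ρ θ`,
Jacobian `ρ²`): the literal one-fibre datum over the flat sector piece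
`{rows, 0 < y < x < ε, u < t < v}` at a corner at the origin (base pole `y = 0`, letter `0`,
rows and bounds through the origin) is congruent modulo `KZ.relations` to the literal datum
`[{rows', 0 < ρ < ε, 0 < η < 1, U(η) < θ < V(η)}, R(ρ)/η · 1/θ]` with `ρ`-free bounds. -/
theorem rebaseSimplePos_cornerBlowUp (m m' : ℕ) (ε : ℚ) (s : KZ.IntegralRep (1 + 1 + 1)) (M : Fin m' → (Fin (1 + 1) → ℚ) × ℚ) (L : Fin m → (Fin 1 → ℚ) × ℚ) (e : Fin m → ℕ) (p : MvPolynomial (Fin 1) ℚ) (ℓ₁ : (Fin 1 → ℚ) × ℚ) (u v : (Fin (1 + 1) → ℚ) × ℚ) (hdom : s.domain = SeparatePos.gDom 1 1 (m' + 4) (Fin.append M (RebasePos.boxRowsL ε)) (fun _ => Sum.inr u) (fun _ => Sum.inr v)) (hint : EqOn s.integrand (RebasePos.glit 1 1 p L e ℓ₁ 0 0 1 (fun _ => some 0)) s.domain) (hM : ∀ j, (M j).1 1 ≠ 0 → (M j).2 = 0) (hu : u.2 = 0) (hv : v.2 = 0) : ∃ s' : KZ.IntegralRep (1 + 1 + 1),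 Bornology.IsBounded s'.domain ∧ s'.domain = SeparatePos.gDom 1 1 (m' + 4) (Fin.append (fun j => RebasePos.chartRowL (M j)) (RebasePos.outRowsL ε)) (fun _ => Sum.inr (RebasePos.chartFL u)) (fun _ => Sum.inr (RebasePos.chartFL v)) ∧ s'.integrand = RebasePos.glit 1 1 p L e ℓ₁ 0 0 1 (fun _ => some 0) ∧ (∀ w, w ∈ s'.domain ↔ RebasePos.blowL w ∈ s.domain) ∧ KZ.of s - KZ.of s' ∈ KZ.relations :=
  RebasePos.cornerBlowUp ε s M L e p ℓ₁ u v hdom hint hM hu hv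

end Summit.KontsevichZagierPeriods.ArrangementNormalForm.JanusBands
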